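import Literature.MathematicalPhysics.QuantumFieldTheory.Balaban1983to89.B5Strip145
import Literature.MathematicalPhysics.QuantumFieldTheory.Balaban1983to89.B4StripCauchy

/-!
# `Balaban1983to89.B5Strip145Leaves` — the four analytic leaves of `B5Strip145`, kernel-discharged

T. Bałaban, *Propagators and renormalization transformations for lattice gauge theories. I*,
Commun. Math. Phys. **95**, 17–40 (1984) [Balaban1984PropagatorsI] (cell paper B5), p. 26 [PDF 10] (1.45) and p. 38 [PDF 22];
technique of T. Bałaban, *Regularity and decay of lattice Green's functions*, Commun. Math. Phys. **89**, 571–597 (1983)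
[Balaban1983RegularityDecay] (cell paper B4 = B5's reference [2]), p. 586 [PDF 16].

CITATION HEADER (lean-in-tree rule 2026-08-18).  This module is a SUPPLEMENT, not a quotation.  B5 asserts (p. 38 [PDF 22],
the sentence before (1.126), verbatim): *"They follow from the representation P = G′Q′*(Q′G′²Q′*)⁻¹Q′G′, from Lemma 2.4 of
[2], and the representation (1.45) and the analyticity method of proving an exponential decay (see the proof of Lemma 2.4 in
[2])"*; and [2] = B4 says of its own strip step only (p. 586 [PDF 16] l. 9–11, verbatim): *"It is more troublesome, but
equally elementary, to prove that this neighbourhood can be chosen independently of j and that the expression is bounded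
also in this neighbourhood."*  Neither paper prints the argument.  Under the cell's rule such a step enters ONLY as
kernel-checked theorems plus a written proof whose external inputs are published theorems quoted verbatim; the written proof
for (1.45) is `HOME/b2b-balaban-b05-g2/QGGQ-strip-census.md` §§1–2 (census C-B5-18), and the sibling module
`…Balaban1983to89.B5Strip145` (B05 cell, untouched, IMPORTED) typed its conclusion as the reduction
`B5Strip145.uniformStrip145_of_leaves : UniformLeaves145 … → UniformStrip145 d a₋ a₊` from FOUR ANALYTIC LEAVES
(`B5Strip145.UniformLeaves145`: Im-Lipschitz constants `Λ_E`, `Λ_N` and sup bounds `M_E`, `M_N` of the regrouped denominator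
`E` and numerator `𝒩` on strips of half-width `≤ r`, uniformly in `n = L^k` and `a ∈ [a₋, a₊]`), left as hypotheses there.

WHAT THIS FILE DOES (0 sorry, no axiom, no `opaque`; NO published theorem is used as a hypothesis — Cauchy's estimate enters
as Mathlib's theorem `Complex.norm_deriv_le_of_forall_mem_sphere_norm_le` through the sibling module
`…Balaban1983to89.B4StripCauchy` (B04 cell, IMPORTED, untouched), whose abstract lemma `imLipschitz_of_fat` — any function
slice-holomorphic on the fat region `F_r = {|Re q_ν| ≤ π + r, |Im q_ν| ≤ 2r}` and bounded by `M` there is Im-Lipschitz with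
constant `M/r` on every `Strip d κ`, `κ ≤ r` — and n-uniform moduli `norm_U_zero_le` (`‖U₀‖ ≤ 4^d`), `norm_DeltaXi_le`
(`‖Δ‖ ≤ 16d + m²`), `norm_DeltaXi_shift_ge` (`‖Δ(· + 2πk)‖ ≥ 2`, `k ≠ 0`), `sum_norm_U_le` (`Σ_k ‖U_k‖ ≤ 132^d`) are reused):
* §1 `norm_Xne_le`, `norm_Ncal_le` — on `F_r` (`r ≤ 1/4`, `d r² ≤ 1/16`): `‖X_{≠0}‖ ≤ 132^d/4` and
  `‖𝒩‖ ≤ M_N(d) := 4^d + (16d)²·132^d/4` (`boundN`), all `n ≥ 1`;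
* §2 `differentiableAt_Ncal_slice` — every coordinate slice of `𝒩` through a point of `F_r` is holomorphic (the shifted
  denominators `Δ(q + 2πk)`, `k ≠ 0`, do not vanish on `F_r`);
* §3 the leaves and the theorem: `imLipschitzN_holds` (LEAF 2: `ImLipschitzN d n κ (M_N/r)`), `norm_Ncal_le_strip` (LEAF 4),
  `norm_E_le_strip` (LEAF 3: `‖E n a 0 ·‖ ≤ M_E := B4StripCauchy.boundM d (max |a₋| |a₊|) 0`), LEAF 1 being
  `B4StripCauchy.uniformImLipschitz_holds … 0`; hence `uniformLeaves145_holds :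
  UniformLeaves145 d a₋ a₊ (rOf d) (LambdaOf d a₋ a₊ 0) (LambdaN d) (boundM d (max |a₋| |a₊|) 0) (boundN d)` and
  **`uniformStrip145_holds (ha : 0 < a₋) : B5Strip145.UniformStrip145 d a₋ a₊`** — the `k`-uniform complex strip for the
  multiplier (1.45) (zero-free denominator, modulus of `𝒩/E²` in `[c, C]` on one strip for every `k`) is a THEOREM.
  Constants: `r = rOf d = 1/(4(d+1))`; `κ₀ = min r (min (c_E/(Λ_E d+1)) (c_N/(Λ_N d+1)))`, `c_E = ½a₋(4/π²)^d`,
  `c_N = ½(4/π²)^d`, `c = c_N/M_E²`, `C = M_N/c_E²` as fixed inside `B5Strip145.uniformStrip145_of_leaves`.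

CONSTANTS DIFFER from QGGQ-strip-census.md §2 (`r = 1/(4√d)`, `M_N = 2.495^d + (10.2d)²C_U/3.74²`, …) — immaterial, since
`UniformStrip145` is existential in `(κ, c, C)`; recorded as DIVERGENCE D-b04g3-2 of the cell.  Value = kernel certificate of a
cell-supplied proof of a located by-reference step (B5 p. 38 ← B4 p. 586); NOT summit progress.  Unit b2b-balaban-b04-g3
(B04 cell, gen 3; B4 → B5 edge); staged byte-identically under `HOME/lean/BalabanYm4/`.
-/

namespace Literature.MathematicalPhysics.QuantumFieldTheory.Balaban1983to89.B5Strip145Leaves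

open Complex Finset Metric
open Literature.MathematicalPhysics.QuantumFieldTheory.Balaban1983to89.B4Strip
open Literature.MathematicalPhysics.QuantumFieldTheory.Balaban1983to89.B4StripCauchy
open Literature.MathematicalPhysics.QuantumFieldTheory.Balaban1983to89.B5Strip145

noncomputable section

variable {d : ℕ}

/-! ### §1 The modulus of the regrouped numerator `𝒩` on the fat region -/

/-- the sup bound `M_N(d) = 4^d + (16d)²·132^d/4` of the regrouped numerator `𝒩` on the fat region `F_r`
(QGGQ-strip-census.md §2 calls the analogous constant `N₊(d)`; values differ, DIVERGENCE D-b04g3-2). [folklore] -/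
def boundN (d : ℕ) : ℝ := 4 ^ d + (16 * (d : ℝ)) ^ 2 * (132 ^ d / 4)

/-- `M_N > 0`. [folklore] -/
theorem boundN_pos (d : ℕ) : 0 < boundN d := by unfold boundN; positivity

/-- `‖X_{≠0}(q)‖ ≤ 132^d/4` on `F_r` (`r ≤ 1/4`, `d r² ≤ 1/16`), all `n ≥ 1`: each shifted denominator has modulus `≥ 2`
(`B4StripCauchy.norm_DeltaXi_shift_ge`) and `Σ_k ‖U_k‖ ≤ 132^d` (`B4StripCauchy.sum_norm_U_le`). [folklore] -/
theorem norm_Xne_le (n : ℕ) [NeZero n] {r : ℝ} (hr : r ≤ 1 / 4) (hdr : (d : ℝ) * r ^ 2 ≤ 1 / 16)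
    {q : Fin d → ℂ} (hq : q ∈ Fat d r) : ‖Xne n q‖ ≤ 132 ^ d / 4 := by
  unfold Xne
  have hterm : ∀ k ∈ Finset.univ.erase (fun _ => (0 : Fin n)),
      ‖U n k q / (DeltaXi n 0 (shift n k q)) ^ 2‖ ≤ ‖U n k q‖ / 4 := by
    intro k hk
    have h2 : 2 ≤ ‖DeltaXi n 0 (shift n k q)‖ :=
      norm_DeltaXi_shift_ge n 0 le_rfl hr hdr hq k (Finset.ne_of_mem_erase hk)
    rw [norm_div, norm_pow]
    have h4 : (4 : ℝ) ≤ ‖DeltaXi n 0 (shift n k q)‖ ^ 2 := by nlinarith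
    exact div_le_div_of_nonneg_left (norm_nonneg _) (by norm_num) h4
  calc ‖∑ k ∈ Finset.univ.erase (fun _ => (0 : Fin n)), U n k q / (DeltaXi n 0 (shift n k q)) ^ 2‖
      ≤ ∑ k ∈ Finset.univ.erase (fun _ => (0 : Fin n)), ‖U n k q / (DeltaXi n 0 (shift n k q)) ^ 2‖ :=
        norm_sum_le _ _
    _ ≤ ∑ k ∈ Finset.univ.erase (fun _ => (0 : Fin n)), ‖U n k q‖ / 4 := Finset.sum_le_sum hterm
    _ ≤ ∑ k : Fin d → Fin n, ‖U n k q‖ / 4 := by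
        apply Finset.sum_le_sum_of_subset_of_nonneg (Finset.erase_subset _ _)
        intro k _ _
        positivity
    _ = (∑ k : Fin d → Fin n, ‖U n k q‖) / 4 := by rw [Finset.sum_div]
    _ ≤ 132 ^ d / 4 := by
        gcongr
        exact sum_norm_U_le n hr hq

/-- `‖𝒩(q)‖ ≤ M_N(d)` on `F_r` (`r ≤ 1/4`, `d r² ≤ 1/16`), all `n ≥ 1` (`‖U₀‖ ≤ 4^d`, `‖Δ‖ ≤ 16d`, `‖X_{≠0}‖ ≤ 132^d/4`).
[folklore] -/
theorem norm_Ncal_le (n : ℕ) [NeZero n] {r : ℝ} (hr : r ≤ 1 / 4) (hdr : (d : ℝ) * r ^ 2 ≤ 1 / 16)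
    {q : Fin d → ℂ} (hq : q ∈ Fat d r) : ‖Ncal n q‖ ≤ boundN d := by
  have hn : 1 ≤ n := Nat.one_le_iff_ne_zero.mpr (NeZero.ne n)
  have h1 : ‖U n (fun _ => (0 : Fin n)) q‖ ≤ 4 ^ d := norm_U_zero_le n hr hq
  have h2 : ‖DeltaXi n 0 q‖ ≤ 16 * d + 0 := norm_DeltaXi_le n hn 0 le_rfl hr hq
  have h3 : ‖Xne n q‖ ≤ 132 ^ d / 4 := norm_Xne_le n hr hdr hq
  have h2' : ‖DeltaXi n 0 q‖ ≤ 16 * d := by linarith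
  have h5 : ‖DeltaXi n 0 q‖ ^ 2 ≤ (16 * (d : ℝ)) ^ 2 := pow_le_pow_left₀ (norm_nonneg _) h2' 2
  have h6 : ‖DeltaXi n 0 q‖ ^ 2 * ‖Xne n q‖ ≤ (16 * (d : ℝ)) ^ 2 * (132 ^ d / 4) :=
    mul_le_mul h5 h3 (norm_nonneg _) (by positivity)
  unfold Ncal boundN
  calc ‖U n (fun _ => (0 : Fin n)) q + DeltaXi n 0 q ^ 2 * Xne n q‖
      ≤ ‖U n (fun _ => (0 : Fin n)) q‖ + ‖DeltaXi n 0 q ^ 2 * Xne n q‖ := norm_add_le _ _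
    _ = ‖U n (fun _ => (0 : Fin n)) q‖ + ‖DeltaXi n 0 q‖ ^ 2 * ‖Xne n q‖ := by rw [norm_mul, norm_pow]
    _ ≤ 4 ^ d + (16 * (d : ℝ)) ^ 2 * (132 ^ d / 4) := by linarith

/-! ### §2 Slice holomorphy of `𝒩` on the fat region -/

/-- every coordinate slice of `𝒩` through a point of the fat region is holomorphic there, uniformly in `n ≥ 1` (entire
symbols `S_ξ`, the block factors via `B4StripCauchy.differentiableAt_uFactor_zero/_ne`, and the shifted denominators
`Δ(q + 2πk)`, `k ≠ 0`, which have real part `≥ 2` on `F_r` by `B4StripCauchy.re_DeltaXi_shift_ge`). [folklore] -/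
theorem differentiableAt_Ncal_slice (n : ℕ) [NeZero n] {r : ℝ} (hr : r ≤ 1 / 4)
    (hdr : (d : ℝ) * r ^ 2 ≤ 1 / 16) {q : Fin d → ℂ} (hq : q ∈ Fat d r) (μ : Fin d) :
    DifferentiableAt ℂ (fun w => Ncal n (Function.update q μ w)) (q μ) := by
  have hn : 1 ≤ n := Nat.one_le_iff_ne_zero.mpr (NeZero.ne n)
  have hπ := Real.pi_gt_three
  have hcoord : ∀ ν, Differentiable ℂ (fun w : ℂ => Function.update q μ w ν) :=
    differentiable_update_apply q μ
  have hat : ∀ ν, Function.update q μ (q μ) ν = q ν := by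
    intro ν; rw [Function.update_eq_self]
  have hΔ : DifferentiableAt ℂ (fun w => DeltaXi n 0 (Function.update q μ w)) (q μ) := by
    simp only [DeltaXi]
    apply DifferentiableAt.add_const
    apply DifferentiableAt.fun_sum
    intro ν _
    exact ((differentiable_Sxi n).comp (hcoord ν)) (q μ)
  have hΔk : ∀ k : Fin d → Fin n, DifferentiableAt ℂ
      (fun w => DeltaXi n 0 (shift n k (Function.update q μ w))) (q μ) := by
    intro k
    simp only [DeltaXi, shift]
    apply DifferentiableAt.add_const
    apply DifferentiableAt.fun_sum
    intro ν _
    exact ((differentiable_Sxi n).comp ((hcoord ν).add_const _)) (q μ)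
  have hU : ∀ k : Fin d → Fin n,
      DifferentiableAt ℂ (fun w => U n k (Function.update q μ w)) (q μ) := by
    intro k
    simp only [U]
    apply DifferentiableAt.fun_finsetProd
    intro ν _
    have hF : DifferentiableAt ℂ (uFactor n (k ν : ℕ)) (Function.update q μ (q μ) ν) := by
      rw [hat ν]
      by_cases hk : (k ν : ℕ) = 0
      · rw [hk]
        exact differentiableAt_uFactor_zero n hn (by linarith [(hq ν).1, hr])
      · exact differentiableAt_uFactor_ne n _ hk
          (Sxi_shift_ne_zero n _ (Nat.one_le_iff_ne_zero.mpr hk) (k ν).isLt hr (hq ν).1)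
    exact hF.comp (q μ) ((hcoord ν) (q μ))
  have hne : ∀ k ∈ Finset.univ.erase (fun _ => (0 : Fin n)),
      DeltaXi n 0 (shift n k (Function.update q μ (q μ))) ≠ 0 := by
    intro k hk h
    rw [Function.update_eq_self] at h
    have := re_DeltaXi_shift_ge n 0 le_rfl hr hdr hq k (Finset.ne_of_mem_erase hk)
    rw [h, Complex.zero_re] at this
    linarith
  simp only [Ncal, Xne]
  apply DifferentiableAt.fun_add (hU _)
  apply DifferentiableAt.fun_mul (hΔ.pow 2)
  apply DifferentiableAt.fun_sum
  intro k hk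
  exact (hU k).fun_div ((hΔk k).pow 2) (pow_ne_zero 2 (hne k hk))

/-! ### §3 The four leaves and the theorem -/

/-- the Im-Lipschitz constant `Λ_N = M_N / r` of `𝒩` (Cauchy's estimate on coordinate discs of radius `r = 1/(4(d+1))`).
[folklore] -/
def LambdaN (d : ℕ) : ℝ := boundN d / rOf d

/-- `Λ_N ≥ 0`. [folklore] -/
theorem LambdaN_nonneg (d : ℕ) : 0 ≤ LambdaN d := (div_pos (boundN_pos d) (rOf_pos d)).le

/-- LEAF 2 (kernel): `𝒩` is Im-Lipschitz on every strip of half-width `κ ≤ r`, `0 ≤ κ`, with constant `Λ_N = M_N/r`,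
for all `n ≥ 1` — `B4StripCauchy.imLipschitz_of_fat` applied to `𝒩` with §1–§2. [folklore] -/
theorem imLipschitzN_holds (n : ℕ) [NeZero n] {κ : ℝ} (hκ0 : 0 ≤ κ) (hκ : κ ≤ rOf d) :
    ImLipschitzN d n κ (LambdaN d) := by
  intro p hp
  exact imLipschitz_of_fat (Ncal n) (rOf_pos d) hκ0 hκ
    (fun q hq μ => differentiableAt_Ncal_slice n (rOf_le d) (d_mul_rOf_sq_le d) hq μ)
    (fun q hq => norm_Ncal_le n (rOf_le d) (d_mul_rOf_sq_le d) hq) p hp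

/-- LEAF 4 (kernel): `‖𝒩‖ ≤ M_N` on every strip of half-width `κ ≤ r`, all `n ≥ 1`. [folklore] -/
theorem norm_Ncal_le_strip (n : ℕ) [NeZero n] {κ : ℝ} (hκ : κ ≤ rOf d) :
    ∀ p ∈ Strip d κ, ‖Ncal n p‖ ≤ boundN d := fun _ hp =>
  norm_Ncal_le n (rOf_le d) (d_mul_rOf_sq_le d) (strip_subset_fat (rOf_pos d).le hκ hp)

/-- LEAF 3 (kernel): `‖E(·; a, m² = 0)‖ ≤ M_E := boundM d (max |a₋| |a₊|) 0` on every strip of half-width `κ ≤ r`, for all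
`n ≥ 1` and `a ∈ [a₋, a₊]` (`B4StripCauchy.norm_E_le` + monotonicity of `boundM` in the coupling bound). [folklore] -/
theorem norm_E_le_strip (n : ℕ) [NeZero n] {aminus aplus a κ : ℝ} (ha1 : aminus ≤ a) (ha2 : a ≤ aplus)
    (hκ : κ ≤ rOf d) : ∀ p ∈ Strip d κ, ‖E n a 0 p‖ ≤ boundM d (max |aminus| |aplus|) 0 := by
  intro p hp
  have h1 := norm_E_le n a 0 0 le_rfl le_rfl (rOf_le d) (d_mul_rOf_sq_le d)
    (strip_subset_fat (rOf_pos d).le hκ hp)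
  have h2 : |a| ≤ max |aminus| |aplus| := abs_le_max_abs_abs ha1 ha2
  exact h1.trans (boundM_mono d h2 0)

/-- THE FOUR LEAVES HOLD (kernel), with `r = 1/(4(d+1))`, `Λ_E = M_E/r` (`B4StripCauchy.LambdaOf d a₋ a₊ 0`),
`Λ_N = M_N/r`, `M_E = boundM d (max |a₋| |a₊|) 0`, `M_N = boundN d` — constants independent of `n = L^k` and of
`a ∈ [a₋, a₊]`; LEAF 1 is `B4StripCauchy.uniformImLipschitz_holds` at `m² = 0`. [folklore] -/
theorem uniformLeaves145_holds (d : ℕ) (aminus aplus : ℝ) :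
    UniformLeaves145 d aminus aplus (rOf d) (LambdaOf d aminus aplus 0) (LambdaN d)
      (boundM d (max |aminus| |aplus|) 0) (boundN d) := by
  obtain ⟨hr, hΛ, hlip⟩ := uniformImLipschitz_holds d aminus aplus 0
  refine ⟨hr, hΛ, LambdaN_nonneg d, ?_⟩
  intro n _ a κ ha1 ha2 hκ0 hκ
  exact ⟨hlip n a 0 κ ha1 ha2 le_rfl le_rfl hκ0 hκ, imLipschitzN_holds n hκ0.le hκ,
    norm_E_le_strip n ha1 ha2 hκ, norm_Ncal_le_strip n hκ⟩

/-- `M_E > 0` as soon as the coupling bound is positive (`M_E ≥ A·4^d ≥ A`). [folklore] -/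
theorem boundM_pos (d : ℕ) {A : ℝ} (hA : 0 < A) (mplus : ℝ) : 0 < boundM d A mplus := by
  unfold boundM
  have h1 : (1 : ℝ) ≤ 4 ^ d := one_le_pow₀ (by norm_num)
  have h2 : (0 : ℝ) ≤ 16 * (d : ℝ) + |mplus| := by positivity
  have h3 : (0 : ℝ) ≤ A * ((16 * d + |mplus|) / 2 * 132 ^ d) := by positivity
  nlinarith

/-- **THEOREM (the `k`-uniform complex strip for the multiplier (1.45)).**  For `d ≥ 0` and `0 < a₋ ≤ a₊` there are
`κ > 0` and `0 < c ≤ C` such that for EVERY `n = L^k ≥ 1` and every `a ∈ [a₋, a₊]` the regrouped multiplier `𝒩/E²` (= the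
printed (1.45) off the zero set, `B5Strip145.mReg_eq_m145`) has a zero-free denominator and modulus in `[c, C]` on
`Strip d κ` — `B5Strip145.UniformStrip145 d a₋ a₊`, the statement B5 p. 38 invokes by reference to "the analyticity
method … (see the proof of Lemma 2.4 in [2])", is a theorem (B5's reduction `uniformStrip145_of_leaves` + the four kernel
leaves above). [folklore] -/
theorem uniformStrip145_holds (d : ℕ) (aminus aplus : ℝ) (ha : 0 < aminus) :
    UniformStrip145 d aminus aplus :=
  uniformStrip145_of_leaves d aminus aplus _ _ _ _ _ ha
    (boundM_pos d (lt_of_lt_of_le ha ((le_abs_self aminus).trans (le_max_left _ _))) 0)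
    (uniformLeaves145_holds d aminus aplus)

end

end Literature.MathematicalPhysics.QuantumFieldTheory.Balaban1983to89.B5Strip145Leaves
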